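import Mathlib.MeasureTheory.Integral.IntervalIntegral.Basic
import Mathlib.MeasureTheory.Integral.DominatedConvergence
import Mathlib.Analysis.SpecialFunctions.Pow.Real

/-!
# Regular-condensate theorem, stub RC-E: the ODE endgame

Lead c7 of the line `log-kantorovich-enstrophy-transfer` for the crux `TwoAndHalfD.TwohalfdNeg`
(stmt-AnomalousDissipation-0211). Pure real analysis closing the block argument of the
regular-condensate theorem: on a block `[0, S]` the limit scalar has the conservative balance
`e(t) = e₀ + ∫₀ᵗ p` (`e = ½‖Θ‖²`, power `p = (h, Θ)`), with `|p| ≤ M √e` (Cauchy–Schwarz,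
`M = √2 ‖h‖`), total power `∫₀^S p ≥ c S` and mean level `∫₀^S e ≤ Λ S`; then the block cannot be
long: `S ≤ 2Λ(c² + 4M²Λ)/c³`.

Proof: `e(S) ≥ cS`; for `t ≤ S`, `e(S) - e(t) = ∫ₜ^S p ≤ ∫ₜ^S M(e/(2r) + r/2) ≤ MΛS/(2r) + Mrσ/2`
whenever `S - t ≤ σ` (AM–GM `√e ≤ e/(2r) + r/2`, `∫ₜ^S e ≤ ΛS`), so `e ≥ cS/2` on `[S - σ, S]` as soon
as `MΛS/r + Mrσ ≤ cS`, whence `σ cS/2 ≤ ∫₀^S e ≤ ΛS` (`endgame_core`); the registered stub takes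
`r = 2MΛ/c`, `σ = S c²/(c² + 4M²Λ)` (degenerate cases `M = 0`, `Λ = 0` are contradictory).
-/

namespace Summit.AnomalousDissipation.AnomalousDissipation.Theorems.TwohalfdNeg.RegularCondensate

open MeasureTheory Set intervalIntegral

set_option linter.dupNamespace false

/-- AM–GM for the square root: `√x ≤ x/(2r) + r/2` for `x ≥ 0`, `r > 0`. [folklore] -/
theorem endgame_sqrt_le {x r : ℝ} (hx : 0 ≤ x) (hr : 0 < r) :
    Real.sqrt x ≤ x / (2 * r) + r / 2 := by
  have h1 : Real.sqrt x ^ 2 = x := Real.sq_sqrt hx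
  have h2 : 0 ≤ (Real.sqrt x - r) ^ 2 := sq_nonneg _
  rw [div_add_div _ _ (by positivity) (by norm_num), le_div_iff₀ (by positivity)]
  nlinarith [Real.sqrt_nonneg x]

/-- **Core of the endgame.** With the conservative balance `e(t) = e₀ + ∫₀ᵗ p` on `[0, S]`,
`e ≥ 0`, `|p| ≤ M√e` a.e., power `∫₀^S p ≥ cS`, level `∫₀^S e ≤ ΛS`, and auxiliary parameters
`r > 0`, `0 < σ ≤ S` with `MΛS/r + Mrσ ≤ cS`: `σ · cS/2 ≤ ΛS` (the level is at least `cS/2` on the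
terminal window of length `σ`). [folklore] -/
theorem endgame_core {e p : ℝ → ℝ} {e₀ c Λ M S r σ : ℝ} (hM : 0 ≤ M) (hS : 0 < S) (he₀ : 0 ≤ e₀)
    (hp : IntegrableOn p (Ioc 0 S) volume)
    (he : ∀ t ∈ Icc 0 S, e t = e₀ + ∫ τ in Ioc 0 t, p τ) (he0 : ∀ t ∈ Icc 0 S, 0 ≤ e t)
    (hpM : ∀ᵐ τ ∂(volume.restrict (Ioc 0 S)), |p τ| ≤ M * Real.sqrt (e τ))
    (hpow : c * S ≤ ∫ τ in Ioc 0 S, p τ) (hlev : ∫ t in Ioc 0 S, e t ≤ Λ * S)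
    (hr : 0 < r) (hσ : 0 < σ) (hσS : σ ≤ S) (hcon : M * Λ * S / r + M * r * σ ≤ c * S) :
    σ * (c * S / 2) ≤ Λ * S := by
  -- interval integrability of `p` on subintervals of `[0, S]`
  have hpI : ∀ a b, 0 ≤ a → a ≤ b → b ≤ S → IntervalIntegrable p volume a b := fun a b ha hab hb =>
    (intervalIntegrable_iff_integrableOn_Ioc_of_le hab).2 (hp.mono_set (Ioc_subset_Ioc ha hb))
  -- `e` as a primitive, its continuity and integrability
  have he' : ∀ t ∈ Icc 0 S, e t = e₀ + ∫ τ in (0 : ℝ)..t, p τ := fun t ht => by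
    rw [he t ht, integral_of_le ht.1]
  have hec : ContinuousOn e (Icc 0 S) := by
    have h1 : ContinuousOn (fun t => e₀ + ∫ τ in (0 : ℝ)..t, p τ) (uIcc 0 S) :=
      continuousOn_const.add (continuousOn_primitive_interval' (hpI 0 S le_rfl hS.le le_rfl) left_mem_uIcc)
    rw [uIcc_of_le hS.le] at h1
    exact h1.congr fun t ht => he' t ht
  have heI : ∀ a b, 0 ≤ a → a ≤ b → b ≤ S → IntervalIntegrable e volume a b := fun a b ha hab hb => by
    refine (hec.mono ?_).intervalIntegrable
    rw [uIcc_of_le hab]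
    exact Icc_subset_Icc ha hb
  have heS_int : IntegrableOn e (Ioc 0 S) volume :=
    (intervalIntegrable_iff_integrableOn_Ioc_of_le hS.le).1 (heI 0 S le_rfl hS.le le_rfl)
  -- the terminal level
  have heS : c * S ≤ e S := by
    rw [he S ⟨hS.le, le_rfl⟩]
    linarith
  -- the level on `[0, S]` in interval form is at most `Λ S`
  have hlev' : ∫ t in (0 : ℝ)..S, e t ≤ Λ * S := by rwa [integral_of_le hS.le]
  -- the level stays `≥ cS/2` on the terminal window
  have key : ∀ t ∈ Icc (S - σ) S, c * S / 2 ≤ e t := by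
    intro t ht
    have ht0 : 0 ≤ t := le_trans (by linarith) ht.1
    have htS : t ≤ S := ht.2
    -- split the power integral at `t`
    have hsplit : e S - e t = ∫ τ in t..S, p τ := by
      rw [he' S ⟨hS.le, le_rfl⟩, he' t ⟨ht0, htS⟩,
        ← integral_add_adjacent_intervals (hpI 0 t le_rfl ht0 htS) (hpI t S ht0 htS le_rfl)]
      ring
    -- pointwise AM–GM bound on the power, a.e. on `(t, S]`
    have hbound : ∫ τ in t..S, p τ ≤ ∫ τ in t..S, (M / (2 * r) * e τ + M * r / 2) := by
      refine integral_mono_ae_restrict htS (hpI t S ht0 htS le_rfl)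
        (((heI t S ht0 htS le_rfl).const_mul _).add intervalIntegrable_const) ?_
      rw [Filter.EventuallyLE, ← Measure.restrict_congr_set Ioc_ae_eq_Icc]
      have hsub : Ioc t S ⊆ Ioc 0 S := Ioc_subset_Ioc_left ht0
      filter_upwards [ae_restrict_of_ae_restrict_of_subset hsub hpM,
        ae_restrict_mem measurableSet_Ioc] with τ hτ hτmem
      have heτ : 0 ≤ e τ := he0 τ ⟨le_trans ht0 hτmem.1.le, hτmem.2⟩
      calc p τ ≤ |p τ| := le_abs_self _
        _ ≤ M * Real.sqrt (e τ) := hτ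
        _ ≤ M * (e τ / (2 * r) + r / 2) := mul_le_mul_of_nonneg_left (endgame_sqrt_le heτ hr) hM
        _ = M / (2 * r) * e τ + M * r / 2 := by ring
    have heval : ∫ τ in t..S, (M / (2 * r) * e τ + M * r / 2) =
        M / (2 * r) * (∫ τ in t..S, e τ) + (S - t) * (M * r / 2) := by
      rw [integral_add ((heI t S ht0 htS le_rfl).const_mul _) intervalIntegrable_const,
        intervalIntegral.integral_const_mul, intervalIntegral.integral_const, smul_eq_mul]
    -- the level integral on `(t, S]` is at most `Λ S`
    have hsub_lev : ∫ τ in t..S, e τ ≤ Λ * S := by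
      refine le_trans (integral_mono_interval ht0 htS le_rfl ?_ (heI 0 S le_rfl hS.le le_rfl)) hlev'
      rw [Filter.EventuallyLE, ae_restrict_iff' measurableSet_Ioc]
      exact Filter.Eventually.of_forall fun τ hτ => he0 τ ⟨hτ.1.le, hτ.2⟩
    have h1 : M / (2 * r) * ∫ τ in t..S, e τ ≤ M / (2 * r) * (Λ * S) :=
      mul_le_mul_of_nonneg_left hsub_lev (by positivity)
    have h2 : (S - t) * (M * r / 2) ≤ σ * (M * r / 2) :=
      mul_le_mul_of_nonneg_right (by linarith [ht.1]) (by positivity)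
    have h3 : M / (2 * r) * (Λ * S) + σ * (M * r / 2) = (M * Λ * S / r + M * r * σ) / 2 := by
      field_simp
    have h4 : e S - e t ≤ c * S / 2 := by
      rw [hsplit]
      linarith [hbound, heval.le, heval.ge]
    linarith
  -- integrate the level over the terminal window
  have hwin : σ * (c * S / 2) ≤ ∫ t in (S - σ)..S, e t := by
    have h1 : ∫ _ in (S - σ)..S, c * S / 2 = σ * (c * S / 2) := by
      rw [intervalIntegral.integral_const, smul_eq_mul]
      ring
    rw [← h1]
    exact integral_mono_on (by linarith) intervalIntegrable_const
      (heI (S - σ) S (by linarith) (by linarith) le_rfl) fun t ht => key t ht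
  have hwin' : ∫ t in (S - σ)..S, e t ≤ ∫ t in (0 : ℝ)..S, e t := by
    refine integral_mono_interval (by linarith) (by linarith) le_rfl ?_ (heI 0 S le_rfl hS.le le_rfl)
    rw [Filter.EventuallyLE, ae_restrict_iff' measurableSet_Ioc]
    exact Filter.Eventually.of_forall fun τ hτ => he0 τ ⟨hτ.1.le, hτ.2⟩
  linarith

/-- **RC-E `stub_rcEndgame` — the ODE endgame (registered stub).** If `e(t) = e₀ + ∫₀ᵗ p ≥ 0` on
`[0, S]` with `e₀ ≥ 0`, `|p| ≤ M √e` a.e., total power `∫₀^S p ≥ c S` and mean level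
`∫₀^S e ≤ Λ S`, then `S ≤ 2Λ(c² + 4M²Λ)/c³`: `endgame_core` with `r = 2MΛ/c`,
`σ = S c²/(c² + 4M²Λ)`; the degenerate cases `M = 0` (then `p = 0` a.e., contradicting the power)
and `Λ = 0` (core with `r = 1`, `σ = min S (cS/M)`) are contradictory. [folklore] -/
theorem stub_rcEndgame :
    ∀ (e p : ℝ → ℝ) (e₀ c Λ M S : ℝ),
      0 < c → 0 ≤ Λ → 0 ≤ M → 0 < S → 0 ≤ e₀ →
      IntegrableOn p (Set.Ioc 0 S) volume →
      (∀ t ∈ Set.Icc 0 S, e t = e₀ + ∫ τ in Set.Ioc 0 t, p τ) →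
      (∀ t ∈ Set.Icc 0 S, 0 ≤ e t) →
      (∀ᵐ τ ∂(volume.restrict (Set.Ioc 0 S)), |p τ| ≤ M * Real.sqrt (e τ)) →
      c * S ≤ ∫ τ in Set.Ioc 0 S, p τ →
      ∫ t in Set.Ioc 0 S, e t ≤ Λ * S →
      S ≤ 2 * Λ * (c ^ 2 + 4 * M ^ 2 * Λ) / c ^ 3 := by
  intro e p e₀ c Λ M S hc hΛ hM hS he₀ hp he he0 hpM hpow hlev
  rcases hM.eq_or_lt with hM0 | hMpos
  · -- `M = 0`: the power vanishes a.e., contradicting `cS ≤ ∫ p`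
    exfalso
    have hp0 : (fun τ => p τ) =ᵐ[volume.restrict (Ioc 0 S)] 0 := by
      filter_upwards [hpM] with τ hτ
      rw [← hM0, zero_mul, abs_nonpos_iff] at hτ
      exact hτ
    have : ∫ τ in Ioc 0 S, p τ = 0 := integral_eq_zero_of_ae hp0
    nlinarith
  rcases hΛ.eq_or_lt with hΛ0 | hΛpos
  · -- `Λ = 0`: the core with `r = 1`, `σ = min S (cS/M)` gives `σ cS/2 ≤ 0`, absurd
    exfalso
    set σ : ℝ := min S (c * S / M) with hσ_def
    have hσ : 0 < σ := lt_min hS (by positivity)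
    have hσS : σ ≤ S := min_le_left _ _
    have hcon : M * Λ * S / 1 + M * 1 * σ ≤ c * S := by
      rw [← hΛ0]
      have h1 : M * σ ≤ M * (c * S / M) := mul_le_mul_of_nonneg_left (min_le_right _ _) hM
      have h2 : M * (c * S / M) = c * S := by field_simp
      linarith
    have h := endgame_core hM hS he₀ hp he he0 hpM hpow hlev one_pos hσ hσS hcon
    rw [← hΛ0, zero_mul] at h
    nlinarith [mul_pos hσ (mul_pos hc hS)]
  · -- main case
    set D : ℝ := c ^ 2 + 4 * M ^ 2 * Λ with hD_def
    have hD : 0 < D := by positivity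
    set r : ℝ := 2 * M * Λ / c with hr_def
    have hr : 0 < r := by positivity
    set σ : ℝ := S * c ^ 2 / D with hσ_def
    have hσ : 0 < σ := by positivity
    have hσS : σ ≤ S := by
      rw [hσ_def, div_le_iff₀ hD]
      nlinarith [mul_nonneg (mul_nonneg (sq_nonneg M) hΛ) hS.le]
    have hcon : M * Λ * S / r + M * r * σ ≤ c * S := by
      have h1 : M * Λ * S / r = c * S / 2 := by
        rw [hr_def]
        field_simp
      have h2 : M * r * σ = 2 * M ^ 2 * Λ * S * c / D := by
        rw [hr_def, hσ_def]
        field_simp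
      have h3 : 2 * M ^ 2 * Λ * S * c / D ≤ c * S / 2 := by
        rw [div_le_iff₀ hD, hD_def]
        nlinarith [mul_pos hc hS, sq_nonneg c, mul_nonneg (mul_nonneg (sq_nonneg M) hΛ) (mul_pos hc hS).le]
      linarith
    have h := endgame_core hM hS he₀ hp he he0 hpM hpow hlev hr hσ hσS hcon
    -- `σ cS/2 ≤ ΛS` with `σ = S c²/D` gives `S c³ ≤ 2ΛD`
    rw [le_div_iff₀ (by positivity)]
    have h' : S * c ^ 2 / D * (c * S / 2) ≤ Λ * S := h
    rw [div_mul_eq_mul_div, div_le_iff₀ hD] at h'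
    nlinarith [mul_pos hS hD, h']

end Summit.AnomalousDissipation.AnomalousDissipation.Theorems.TwohalfdNeg.RegularCondensate
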